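import Literature.MathematicalPhysics.QuantumFieldTheory.Balaban1983to89.Beta.MomentFactorisation
import Literature.MathematicalPhysics.QuantumFieldTheory.Balaban1983to89.Beta.DyadicShell
import Literature.MathematicalPhysics.QuantumFieldTheory.Balaban1983to89.Beta.TransferUV

/-!
# Beta/CrossTermBounds — the six minimizer-dressing cross terms of the (1.22) moment are bounded by products of
moment norms, and degree-six shell decay makes zeroth and first moments bounded (only the second moment is a log)

HONEST FRAMING (cell `pub-balaban`, β sub-cell, row an2 = the background-field / log-det route; HOME/BETA/AN2.md §10;
BETA-SPEC RULING (R8) and the lead's fold: the cross terms are the typed `A₁`-slot item (W3b-J) = (β-st-J), owner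
wanted).  The β sub-cell tries to discharge the one-loop input `FlowStep.BetaPertH` of [Balaban1987RG1] Theorem 2;
discharging it would make Bałaban's ultraviolet STABILITY theorem unconditional — a constructive-QFT statement that is
NOT the continuum limit and NOT the Clay problem — and this file is not even that: it is folklore bookkeeping in a normed
ring.  Value = the typed shape of (W3b-J) (which moment norms must be `(L,k)`-bounded), NOT summit progress.

WHAT IS IN PRINT (context, cited by number; the manuscripts are the object of the audit and are not used as facts).
[Balaban1987RG1] p. 264 (1.20): the polarization `Π_{j+1}` is the second derivative in `B` of
`E^{(j+1)}(g_j, U_{j+1}(exp iB))`, i.e. of the effective-action term COMPOSED WITH THE MINIMIZER MAP; (1.22):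
`β_{j+1}(g_j) = Σ_x Π_{j+1,μν}(g_j,x)x_μx_ν`, `μ ≠ ν`.  By the chain rule at the critical configuration the kernel is a
dressed convolution `h ⋆ T ⋆ h′` (`h`, `h′` the linear responses of the minimizer, `T` the fine-level Hessian), whose
`x_μx_ν`-moment `Beta.MomentFactorisation.M2_dressed_ward` expands EXACTLY, under the Ward-type hypotheses
`M0 h·M0 T = 0 = M0 T·M0 h′`, into the MAIN TERM `M0 h·M2 T·M0 h′` plus SIX CROSS TERMS carrying `M1 T` or `M0 T`.

WHAT THIS FILE PROVES (all [folklore]; `R` any normed ring — matrix-valued kernels allowed).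
* §1 `norm_moment_le`: `‖moment φ f‖ ≤ Σ_{x ∈ supp f} |φ x|·‖f x‖`; the moment as a sum over any sup-norm ball containing
  the support (`moment_eq_sum_box`, `d = 4`).
* §2 `norm_M2_dressed_sub_main_le`: under the Ward-type hypotheses,
  `‖M2_{μν}(h⋆T⋆h′) − M0 h·M2_{μν} T·M0 h′‖ ≤` the six products `‖M1 h‖‖M1 T‖‖M0 h′‖, …, ‖M1 h‖‖M0 T‖‖M1 h′‖`;
  with uniform letters (`‖M0 h‖,‖M0 h′‖ ≤ J₀`, `‖M1 h‖,‖M1 h′‖ ≤ J₁`, `‖M0 T‖ ≤ T₀`, `‖M1 T‖ ≤ T₁`) the cross terms are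
  `≤ 4J₁T₁J₀ + 2J₁T₀J₁` (`norm_cross_le`).  So (W3b-J) «cross terms `(L,k)`-bounded» follows from `(L,k)`-uniform bounds
  on FOUR moment norms: (J-1) `‖M0 j‖, ‖M1 j‖` of the minimizer response and (J-2) `‖M0 T‖, ‖M1 T‖` of the fine Hessian
  organised by unit-lattice offsets — these are the typed inputs; nothing here asserts them for Bałaban's kernels.
* §3 (`d = 4`) POWER COUNTING: if a finitely supported kernel satisfies the shellwise bound `‖f w‖ ≤ C(r+1)⁻⁶` on
  `‖w‖∞ = r+1` (the homogeneity degree of the leg products in `Beta.WindowInterface`, `deg P + deg Q = 6`), then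
  `‖M1_ν f‖ ≤ 160C` and `‖M0 f‖ ≤ ‖f 0‖ + 160C` (`norm_M1_le_of_decay`, `norm_M0_le_of_decay`; shell count `≤ 80(r+1)³`,
  `Σ (r+1)⁻² ≤ 2`), uniformly in the size of the support, whereas the same decay bounds `‖M2_{μν} f‖` only by the HARMONIC
  sum `80C·Σ_{r<N}(r+1)⁻¹` over the shells met by the support (`norm_M2_le_of_decay`) — the `log` of the main term.  This is
  the structural reason the fold expects (W3b-J) to be bounded while the main term carries `log L`.
Nothing here asserts that Bałaban's `j`, `T` satisfy (J-1)/(J-2): that is the open analytic content of (W3b-J)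
(AN2.md §10.12 (D4)–(D5), §10.13 (I2-d)).

References (CONTEXT ONLY; nothing in this file is cited as a fact): T. Bałaban, Renormalization group approach to lattice
gauge field theories. I, Commun. Math. Phys. 109 (1987) 249–301 [Balaban1987RG1] ((1.20)–(1.22) p. 264); T. Bałaban,
The variational problem and background fields in renormalization group method for lattice gauge theories, Commun. Math.
Phys. 102 (1985) 277–309 [Balaban1985Var] ((189)–(190) p. 308: localization of the minimizer, context for (J-1)).
Provenance: β sub-cell row an2 gen 3 (planner seat), journal claim BETA-an2-CROSS; staged byte-identically under
`HOME/lean/BalabanYm4/`.  NOT summit progress.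
-/

namespace Literature.MathematicalPhysics.QuantumFieldTheory.Balaban1983to89.Beta.CrossTermBounds

open Finset
open Literature.Probability.LatticeModels (annulus box box_mono)
open Literature.MathematicalPhysics.QuantumFieldTheory.Balaban1983to89
open Literature.MathematicalPhysics.QuantumFieldTheory.Balaban1983to89.Beta
open Literature.MathematicalPhysics.QuantumFieldTheory.Balaban1983to89.Beta.MomentFactorisation
  (LatFun conv moment M0 M1 M2 M2_dressed_ward)
open Literature.MathematicalPhysics.QuantumFieldTheory.Balaban1983to89.Beta.DyadicShell (Pt toReal supNorm
  sum_Ico_shellSum mem_annulus_iff mem_box_iff supNorm_eq_zero_iff supNorm_eq_of_mem_sphere norm_toReal)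
open Literature.MathematicalPhysics.QuantumFieldTheory.Balaban1983to89.Beta.TransferUV (card_annulus_succ_four_le)
open Literature.MathematicalPhysics.QuantumFieldTheory.Balaban1983to89.Beta.WindowLog (shellSum)

noncomputable section

/-! ## 1. Norms of moments of finitely supported kernels -/

section General

variable {d : ℕ} {R : Type*} [NormedRing R]

/-- `‖moment φ f‖ ≤ Σ_{x ∈ supp f} |φ x|·‖f x‖` (integer weights act by `zsmul`; `‖n • a‖ ≤ |n|‖a‖`). [folklore] -/
theorem norm_moment_le (φ : (Fin d → ℤ) → ℤ) (f : LatFun d R) :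
    ‖moment φ f‖ ≤ ∑ x ∈ f.support, (|(φ x : ℤ)| : ℝ) * ‖f x‖ := by
  unfold moment Finsupp.sum
  refine (norm_sum_le _ _).trans (Finset.sum_le_sum fun x _ => ?_)
  calc ‖φ x • f x‖ ≤ ‖(φ x : ℤ)‖ * ‖f x‖ := norm_zsmul_le _ _
    _ = (|(φ x : ℤ)| : ℝ) * ‖f x‖ := by rw [Int.norm_eq_abs]

/-! ## 2. The six cross terms of `M2_dressed_ward` in norm -/

/-- **(W3b-J) IN NORM.**  Under the Ward-type hypotheses `M0 h·M0 T = 0`, `M0 T·M0 h′ = 0` the difference between the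
`x_μx_ν`-moment of the dressed kernel `h ⋆ T ⋆ h′` and its MAIN TERM `M0 h·M2 T·M0 h′` is bounded by the six products of
moment norms (from `MomentFactorisation.M2_dressed_ward`, triangle inequality, Mathlib `norm_mul₃_le`). [folklore] -/
theorem norm_M2_dressed_sub_main_le (μ ν : Fin d) (h T h' : LatFun d R) (hl : M0 h * M0 T = 0)
    (hr : M0 T * M0 h' = 0) :
    ‖M2 μ ν (conv (conv h T) h') - M0 h * M2 μ ν T * M0 h'‖ ≤
      (‖M1 μ h‖ * ‖M1 ν T‖ * ‖M0 h'‖ + ‖M1 ν h‖ * ‖M1 μ T‖ * ‖M0 h'‖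
        + ‖M0 h‖ * ‖M1 μ T‖ * ‖M1 ν h'‖ + ‖M0 h‖ * ‖M1 ν T‖ * ‖M1 μ h'‖)
      + (‖M1 μ h‖ * ‖M0 T‖ * ‖M1 ν h'‖ + ‖M1 ν h‖ * ‖M0 T‖ * ‖M1 μ h'‖) := by
  rw [M2_dressed_ward μ ν h T h' hl hr]
  have e : ∀ X Y m : R, m + X + Y - m = X + Y := fun X Y m => by abel
  rw [e]
  refine (norm_add_le _ _).trans (add_le_add ?_ ?_)
  · refine (norm_add_le _ _).trans (add_le_add ((norm_add_le _ _).trans (add_le_add ((norm_add_le _ _).trans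
      (add_le_add norm_mul₃_le norm_mul₃_le)) norm_mul₃_le))
      norm_mul₃_le)
  · exact (norm_add_le _ _).trans (add_le_add norm_mul₃_le norm_mul₃_le)

/-- Monotonicity of a triple product of nonnegative reals. [folklore] -/
theorem mul_three_le {a b c A B C : ℝ} (ha : 0 ≤ a) (hb : 0 ≤ b) (hc : 0 ≤ c) (hA : a ≤ A) (hB : b ≤ B)
    (hC : c ≤ C) : a * b * c ≤ A * B * C :=
  mul_le_mul (mul_le_mul hA hB hb (ha.trans hA)) hC hc (mul_nonneg (ha.trans hA) (hb.trans hB))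

/-- **(W3b-J) with uniform letters.**  If `‖M0 h‖, ‖M0 h′‖ ≤ J₀`, `‖M1_μ h‖, ‖M1_ν h‖, ‖M1_μ h′‖, ‖M1_ν h′‖ ≤ J₁`,
`‖M0 T‖ ≤ T₀`, `‖M1_μ T‖, ‖M1_ν T‖ ≤ T₁`, then the six cross terms are `≤ 4·J₁T₁J₀ + 2·J₁T₀J₁`.  READING: (W3b-J) «cross terms
`(L,k)`-bounded» ⟸ (J-1) `(L,k)`-uniform bounds on the zeroth/first moment norms of the minimizer responses and (J-2) on
`‖M0 T‖`, `‖M1 T‖` of the fine Hessian organised by unit-lattice offsets.  Nothing asserted about Bałaban's kernels.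
[folklore] -/
theorem norm_cross_le (μ ν : Fin d) (h T h' : LatFun d R) (hl : M0 h * M0 T = 0) (hr : M0 T * M0 h' = 0)
    {J₀ J₁ T₀ T₁ : ℝ} (h0 : ‖M0 h‖ ≤ J₀) (h0' : ‖M0 h'‖ ≤ J₀) (h1μ : ‖M1 μ h‖ ≤ J₁) (h1ν : ‖M1 ν h‖ ≤ J₁)
    (h1μ' : ‖M1 μ h'‖ ≤ J₁) (h1ν' : ‖M1 ν h'‖ ≤ J₁) (t0 : ‖M0 T‖ ≤ T₀) (t1μ : ‖M1 μ T‖ ≤ T₁)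
    (t1ν : ‖M1 ν T‖ ≤ T₁) :
    ‖M2 μ ν (conv (conv h T) h') - M0 h * M2 μ ν T * M0 h'‖ ≤ 4 * (J₁ * T₁ * J₀) + 2 * (J₁ * T₀ * J₁) := by
  have := norm_M2_dressed_sub_main_le μ ν h T h' hl hr
  have n := fun (a : R) => norm_nonneg a
  have e1 := mul_three_le (n _) (n _) (n _) h1μ t1ν h0'
  have e2 := mul_three_le (n _) (n _) (n _) h1ν t1μ h0'
  have e3 : ‖M0 h‖ * ‖M1 μ T‖ * ‖M1 ν h'‖ ≤ J₁ * T₁ * J₀ := by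
    have := mul_three_le (n _) (n _) (n _) h1ν' t1μ h0; nlinarith [this]
  have e4 : ‖M0 h‖ * ‖M1 ν T‖ * ‖M1 μ h'‖ ≤ J₁ * T₁ * J₀ := by
    have := mul_three_le (n _) (n _) (n _) h1μ' t1ν h0; nlinarith [this]
  have e5 := mul_three_le (n _) (n _) (n _) h1μ t0 h1ν'
  have e6 := mul_three_le (n _) (n _) (n _) h1ν t0 h1μ'
  linarith

end General

/-! ## 3. Power counting on `ℤ⁴`: degree-six shell decay bounds `M0`, `M1`; `M2` is harmonic -/

section Four

variable {R : Type*} [NormedRing R]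

/-- A moment of a finitely supported kernel on `ℤ⁴` is the same weighted sum taken over any sup-norm ball `‖x‖∞ ≤ N`
containing the support. [folklore] -/
theorem moment_eq_sum_box (φ : Pt → ℤ) (f : LatFun 4 R) {N : ℕ} (hN : ∀ x ∈ f.support, supNorm x ≤ N) :
    moment φ f = ∑ x ∈ box 4 N, φ x • f x := by
  unfold moment Finsupp.sum
  refine Finset.sum_subset (fun x hx => mem_box_iff.mpr (hN x hx)) fun x _ hx => ?_
  have : f x = 0 := by simpa [Finsupp.mem_support_iff] using hx
  simp [this]

/-- Splitting a sum over the ball `‖x‖∞ ≤ N` into the origin and the punctured ball `annulus 4 0 N`. [folklore] -/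
theorem sum_box_eq_add_sum_annulus {M : Type*} [AddCommMonoid M] (K : Pt → M) (N : ℕ) :
    ∑ w ∈ box 4 N, K w = K 0 + ∑ w ∈ annulus 4 0 N, K w := by
  have hsub : box 4 0 ⊆ box 4 N := box_mono 4 (Nat.zero_le N)
  have h0 : box 4 0 = {0} := by
    ext w
    rw [mem_box_iff, Finset.mem_singleton, Nat.le_zero, supNorm_eq_zero_iff]
  rw [Literature.Probability.LatticeModels.annulus, ← Finset.sum_sdiff hsub, h0, Finset.sum_singleton, add_comm]

/-- `|x_i| ≤ ‖x‖∞` for a lattice point, in `ℝ`. [folklore] -/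
theorem abs_cast_apply_le_supNorm (x : Pt) (i : Fin 4) : |(x i : ℝ)| ≤ (supNorm x : ℝ) := by
  rw [← norm_toReal x, ← Real.norm_eq_abs]
  exact norm_le_pi_norm (toReal x) i

/-- SHELLWISE NORM BOUND: if `‖F w‖ ≤ a r` on the shell `‖w‖∞ = r+1` with `a ≥ 0`, then
`‖Σ_{0<‖w‖∞≤N} F w‖ ≤ Σ_{r<N} 80(r+1)³·a r` (`#shell ≤ 80(r+1)³`, `TransferUV.card_annulus_succ_four_le`). [folklore] -/
theorem norm_sum_annulus_le {M : Type*} [SeminormedAddCommGroup M] (F : Pt → M) (a : ℕ → ℝ) (ha : ∀ r, 0 ≤ a r)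
    (N : ℕ) (h : ∀ r : ℕ, ∀ w ∈ annulus 4 r (r + 1), ‖F w‖ ≤ a r) :
    ‖∑ w ∈ annulus 4 0 N, F w‖ ≤ ∑ r ∈ Finset.range N, 80 * ((r : ℝ) + 1) ^ 3 * a r := by
  refine (norm_sum_le _ _).trans ?_
  rw [← sum_Ico_shellSum (fun w => ‖F w‖) (Nat.zero_le N), ← Finset.range_eq_Ico]
  refine Finset.sum_le_sum fun r _ => ?_
  calc shellSum (fun w => ‖F w‖) r ≤ ∑ _w ∈ annulus 4 r (r + 1), a r := Finset.sum_le_sum fun w hw => h r w hw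
    _ = ((annulus 4 r (r + 1)).card : ℝ) * a r := by rw [Finset.sum_const, nsmul_eq_mul]
    _ ≤ 80 * ((r : ℝ) + 1) ^ 3 * a r := mul_le_mul_of_nonneg_right (card_annulus_succ_four_le r) (ha r)

/-- `Σ_{r<N} (r+1)⁻² ≤ 2 − 1/N` for `N ≥ 1` (telescoping `(r+1)⁻² ≤ r⁻¹ − (r+1)⁻¹`). [folklore] -/
theorem sum_range_inv_succ_sq_le (N : ℕ) (hN : 1 ≤ N) :
    ∑ r ∈ Finset.range N, 1 / ((r : ℝ) + 1) ^ 2 ≤ 2 - 1 / (N : ℝ) := by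
  induction N, hN using Nat.le_induction with
  | base => norm_num
  | succ N hN ih =>
    rw [Finset.sum_range_succ]
    have hN0 : (0 : ℝ) < N := by exact_mod_cast hN
    have key : 1 / (N : ℝ) - 1 / ((N : ℝ) + 1) - 1 / ((N : ℝ) + 1) ^ 2 = 1 / ((N : ℝ) * ((N : ℝ) + 1) ^ 2) := by
      field_simp
      ring
    have hpos : 0 ≤ 1 / ((N : ℝ) * ((N : ℝ) + 1) ^ 2) := by positivity
    push_cast
    linarith

/-- `Σ_{r<N} 80·C·(r+1)⁻² ≤ 160·C` for `C ≥ 0`. [folklore] -/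
theorem sum_range_inv_sq_mul_le {C : ℝ} (hC : 0 ≤ C) (N : ℕ) :
    ∑ r ∈ Finset.range N, 80 * C / ((r : ℝ) + 1) ^ 2 ≤ 160 * C := by
  have hsum : ∑ r ∈ Finset.range N, 1 / ((r : ℝ) + 1) ^ 2 ≤ 2 := by
    rcases Nat.eq_zero_or_pos N with rfl | hN
    · simp
    · have hN' : (0 : ℝ) < N := by exact_mod_cast hN
      have h1 : (0 : ℝ) < 1 / (N : ℝ) := by positivity
      linarith [sum_range_inv_succ_sq_le N hN]
  calc ∑ r ∈ Finset.range N, 80 * C / ((r : ℝ) + 1) ^ 2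
      = 80 * C * ∑ r ∈ Finset.range N, 1 / ((r : ℝ) + 1) ^ 2 := by
        rw [Finset.mul_sum]; refine Finset.sum_congr rfl fun r _ => ?_; ring
    _ ≤ 80 * C * 2 := by gcongr
    _ = 160 * C := by ring

/-- **FIRST MOMENTS ARE BOUNDED under degree-six decay.**  If `‖f w‖ ≤ C(r+1)⁻⁶` on every shell `‖w‖∞ = r+1`, then
`‖M1_ν f‖ ≤ 160·C`, uniformly in the (finite) support (`|w_ν| ≤ r+1`, `#shell ≤ 80(r+1)³`, `Σ(r+1)⁻² ≤ 2`). [folklore] -/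
theorem norm_M1_le_of_decay (ν : Fin 4) (f : LatFun 4 R) {C : ℝ} (hC : 0 ≤ C)
    (hf : ∀ r : ℕ, ∀ w ∈ annulus 4 r (r + 1), ‖f w‖ ≤ C / ((r : ℝ) + 1) ^ 6) : ‖M1 ν f‖ ≤ 160 * C := by
  set N := f.support.sup supNorm with hNdef
  have hN : ∀ x ∈ f.support, supNorm x ≤ N := fun x hx => Finset.le_sup (f := supNorm) hx
  have hM : M1 ν f = ∑ x ∈ annulus 4 0 N, (x ν) • f x := by
    rw [M1, moment_eq_sum_box _ f hN, sum_box_eq_add_sum_annulus (fun x : Pt => (x ν) • f x) N]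
    simp
  rw [hM]
  refine (norm_sum_annulus_le (fun x : Pt => (x ν) • f x) (fun r => 80⁻¹ * (80 * C / ((r : ℝ) + 1) ^ 2) /
    ((r : ℝ) + 1) ^ 3 * 1) (fun r => by positivity) N fun r w hw => ?_).trans ?_
  · have hr : (supNorm w : ℝ) = (r : ℝ) + 1 := by exact_mod_cast supNorm_eq_of_mem_sphere hw
    have hr1 : (0 : ℝ) < (r : ℝ) + 1 := by positivity
    calc ‖(w ν) • f w‖ ≤ ‖(w ν : ℤ)‖ * ‖f w‖ := norm_zsmul_le _ _
      _ ≤ ((r : ℝ) + 1) * (C / ((r : ℝ) + 1) ^ 6) := by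
          refine mul_le_mul ?_ (hf r w hw) (norm_nonneg _) hr1.le
          rw [Int.norm_eq_abs, ← hr]; exact abs_cast_apply_le_supNorm w ν
      _ = 80⁻¹ * (80 * C / ((r : ℝ) + 1) ^ 2) / ((r : ℝ) + 1) ^ 3 * 1 := by field_simp
  · calc ∑ r ∈ Finset.range N, 80 * ((r : ℝ) + 1) ^ 3 * (80⁻¹ * (80 * C / ((r : ℝ) + 1) ^ 2) / ((r : ℝ) + 1) ^ 3 * 1)
        = ∑ r ∈ Finset.range N, 80 * C / ((r : ℝ) + 1) ^ 2 := by
          refine Finset.sum_congr rfl fun r _ => ?_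
          have hr1 : (0 : ℝ) < (r : ℝ) + 1 := by positivity
          field_simp
      _ ≤ 160 * C := sum_range_inv_sq_mul_le hC N

/-- **ZEROTH MOMENT under degree-six decay**: `‖M0 f‖ ≤ ‖f 0‖ + 160·C` (the origin separately; the punctured sum by
`Σ 80(r+1)³·C(r+1)⁻⁶ ≤ Σ 80C(r+1)⁻²`).  (For Bałaban's `T` the Ward identity kills `M0 T` on constants only; the full norm is
what enters the last two cross terms.) [folklore] -/
theorem norm_M0_le_of_decay (f : LatFun 4 R) {C : ℝ} (hC : 0 ≤ C)
    (hf : ∀ r : ℕ, ∀ w ∈ annulus 4 r (r + 1), ‖f w‖ ≤ C / ((r : ℝ) + 1) ^ 6) : ‖M0 f‖ ≤ ‖f 0‖ + 160 * C := by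
  set N := f.support.sup supNorm with hNdef
  have hN : ∀ x ∈ f.support, supNorm x ≤ N := fun x hx => Finset.le_sup (f := supNorm) hx
  have hM : M0 f = f 0 + ∑ x ∈ annulus 4 0 N, f x := by
    rw [M0, moment_eq_sum_box _ f hN]
    simp only [one_smul]
    exact sum_box_eq_add_sum_annulus (fun x : Pt => f x) N
  rw [hM]
  refine (norm_add_le _ _).trans (add_le_add le_rfl ?_)
  refine (norm_sum_annulus_le (fun x : Pt => f x) (fun r => 80⁻¹ * (80 * C / ((r : ℝ) + 1) ^ 2) /
    ((r : ℝ) + 1) ^ 3 * 1) (fun r => by positivity) N fun r w hw => ?_).trans ?_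
  · have hr1 : (1 : ℝ) ≤ (r : ℝ) + 1 := by linarith [(Nat.cast_nonneg r : (0 : ℝ) ≤ r)]
    have hr0 : (0 : ℝ) < (r : ℝ) + 1 := by positivity
    calc ‖f w‖ ≤ C / ((r : ℝ) + 1) ^ 6 := hf r w hw
      _ ≤ C / ((r : ℝ) + 1) ^ 5 := by
          apply div_le_div_of_nonneg_left hC (by positivity)
          calc ((r : ℝ) + 1) ^ 5 = ((r : ℝ) + 1) ^ 5 * 1 := by ring
            _ ≤ ((r : ℝ) + 1) ^ 5 * ((r : ℝ) + 1) := by gcongr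
            _ = ((r : ℝ) + 1) ^ 6 := by ring
      _ = 80⁻¹ * (80 * C / ((r : ℝ) + 1) ^ 2) / ((r : ℝ) + 1) ^ 3 * 1 := by field_simp
  · calc ∑ r ∈ Finset.range N, 80 * ((r : ℝ) + 1) ^ 3 * (80⁻¹ * (80 * C / ((r : ℝ) + 1) ^ 2) / ((r : ℝ) + 1) ^ 3 * 1)
        = ∑ r ∈ Finset.range N, 80 * C / ((r : ℝ) + 1) ^ 2 := by
          refine Finset.sum_congr rfl fun r _ => ?_
          have hr1 : (0 : ℝ) < (r : ℝ) + 1 := by positivity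
          field_simp
      _ ≤ 160 * C := sum_range_inv_sq_mul_le hC N

/-- **THE SECOND MOMENT IS ONLY HARMONIC under the same decay**: `‖M2_{μν} f‖ ≤ 80C·Σ_{r<N}(r+1)⁻¹` where `‖x‖∞ ≤ N` on the
support (`|x_μx_ν| ≤ (r+1)²`); the harmonic number is the `log` of the main term of the fold — the same power counting that
bounds `M0`, `M1` does NOT bound `M2` uniformly in the support. [folklore] -/
theorem norm_M2_le_of_decay (μ ν : Fin 4) (f : LatFun 4 R) {C : ℝ} (hC : 0 ≤ C)
    (hf : ∀ r : ℕ, ∀ w ∈ annulus 4 r (r + 1), ‖f w‖ ≤ C / ((r : ℝ) + 1) ^ 6) {N : ℕ}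
    (hN : ∀ x ∈ f.support, supNorm x ≤ N) :
    ‖M2 μ ν f‖ ≤ ∑ r ∈ Finset.range N, 80 * C / ((r : ℝ) + 1) := by
  have hM : M2 μ ν f = ∑ x ∈ annulus 4 0 N, (x μ * x ν) • f x := by
    rw [M2, moment_eq_sum_box _ f hN, sum_box_eq_add_sum_annulus (fun x : Pt => (x μ * x ν) • f x) N]
    simp
  rw [hM]
  refine (norm_sum_annulus_le (fun x : Pt => (x μ * x ν) • f x) (fun r => 80⁻¹ * (80 * C / ((r : ℝ) + 1)) /
    ((r : ℝ) + 1) ^ 3 * 1) (fun r => by positivity) N fun r w hw => ?_).trans (le_of_eq ?_)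
  · have hr : (supNorm w : ℝ) = (r : ℝ) + 1 := by exact_mod_cast supNorm_eq_of_mem_sphere hw
    have hr1 : (0 : ℝ) < (r : ℝ) + 1 := by positivity
    have hμ : |(w μ : ℝ)| ≤ (r : ℝ) + 1 := hr ▸ abs_cast_apply_le_supNorm w μ
    have hν : |(w ν : ℝ)| ≤ (r : ℝ) + 1 := hr ▸ abs_cast_apply_le_supNorm w ν
    calc ‖(w μ * w ν) • f w‖ ≤ ‖(w μ * w ν : ℤ)‖ * ‖f w‖ := norm_zsmul_le _ _
      _ ≤ (((r : ℝ) + 1) * ((r : ℝ) + 1)) * (C / ((r : ℝ) + 1) ^ 6) := by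
          refine mul_le_mul ?_ (hf r w hw) (norm_nonneg _) (by positivity)
          rw [Int.norm_eq_abs, Int.cast_mul, abs_mul]
          exact mul_le_mul hμ hν (abs_nonneg _) hr1.le
      _ = 80⁻¹ * (80 * C / ((r : ℝ) + 1)) / ((r : ℝ) + 1) ^ 3 * 1 := by field_simp
  · refine Finset.sum_congr rfl fun r _ => ?_
    have hr1 : (0 : ℝ) < (r : ℝ) + 1 := by positivity
    field_simp

end Four

end

end Literature.MathematicalPhysics.QuantumFieldTheory.Balaban1983to89.Beta.CrossTermBounds
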